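import Mathlib
import Summits.PneNP.PneNP.Theses.OverlapGapAlgebra
import Summits.PneNP.PneNP.Theorems.OverlapGapAlgebraSolvableImpliesStableSectionEtaGeOne
import Summits.PneNP.PneNP.Theorems.OverlapGapAlgebraSolvableImpliesStableSectionConstSection
import Summits.PneNP.PneNP.Theorems.OverlapGapAlgebraSolvableImpliesStableSectionFirstMoment

/-!
# Line `RegimeSplit` for crux stmt-PneNP-2463 (`SolvableImpliesStableSection`) — strategist skeleton v1

Crux-strategist (wall-breaker pass, planner-cstrat-stmt-PneNP-2463-p1-0, 2026-08-17).  The dead line `Sketch`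
(v4.2) ends at ONE stub `stub_transferCore` that mixes two different kinds of debt on the strip
`1/(32k²) < α < 2^k log 2`: f-free geometry (sections at every `ν` below the clustering scale) and the
transfer proper (summit-strength on the Bresler–Huang window, F0/F1).  This line CUTS THE STRIP AT THE
NATURAL ALGORITHMIC THRESHOLDS so that a lead holds two live, non-summit stubs and one parked one:

* `stub_lowDensity`  (child G) — f-free: for every fixed `k ≥ 3`, `0 < α < 2^k/k` (the Unit-Clause regime,
  Chao–Franco) and ALL `η, ν, c > 0`, eventually in `n` some map realises the crux's path event on
  `≥ e^{-cn}·#paths`.  Mechanisms (line card §Stubs): fixed-order Unit Clause succeeds w.u.p.p. + bounded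
  mean-square sensitivity while unit-clause cascades are subcritical + the landed ℓ²-transfer
  `sissMS_concl_of_meanSquareStableSolver` (p120141); or the randomly PINNED GROUND STATE
  `argmin viol_Φ(σ) + Σ λ_i [σ_i ≠ σ₀_i]` (validity free from near-satisfiability, stability = influence
  percolation) + the engine `concl_of_smoothSection` (p109844); in-tree today: `α ≤ 2^k/(4k)` (sissR/sissW).
* `stub_midDensity`  (child M) — f-free: the same on the unclustered strip `2^k/k ≤ α < 2^k log k/k`
  (GUC/SC, `Fix`, BH Thm 2.14 solve there; no stable section reaching every `ν` at fixed `k` is in print).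
* `stub_core`        (child T) — the crux VERBATIM on the core `2^k log k/k ≤ α < 2^k log 2`, `η < 1`,
  `ν ≤ 2^{-k}`: THE BET (inside the BH window ⇔ `¬PolySolvable(k, α_k)` given items 2462/2464,
  `transfer_false_without_polyTime` p111158; implies `PneNP`).  Parked; attack only by class rungs.

`SolvableImpliesStableSection_of` = the case split (also kernel-checked as a stand-alone glue
`Theorems.solvableImpliesStableSection_of_subs`, evidence `split.lean` on the item; the route-level
`--split` into the three children is prepared in `children.json` and deferred by the gate to a final cycle).
Sorries ONLY in `stub_*`.
-/

set_option linter.dupNamespace false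

namespace Summit.PneNP.PneNP.Cruxes.SolvableImpliesStableSection.RegimeSplit

open Finset
open scoped Classical

/-- **Stub 1 — child G: stable sections in the Unit-Clause regime (f-free).**  For every fixed `k ≥ 3`,
every `0 < α < 2^k/k` and all `η, ν, c > 0`: for all large `n` some map `g` is `νm`-valid at every splice
point of the Bresler–Huang path and `ηn`-stable between consecutive splice points on `≥ e^{-cn}·#paths`. -/
theorem stub_lowDensity :
    ∀ k : ℕ, 3 ≤ k → ∀ α η ν : ℝ, 0 < α → α < 2 ^ k / k → 0 < η → 0 < ν → ∀ c : ℝ, 0 < c →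
      ∀ᶠ n : ℕ in Filter.atTop, ∀ m : ℕ, m = ⌊α * n⌋₊ →
        ∃ g : (Fin m → Fin k → Fin n × Bool) → (Fin n → Bool),
          Real.exp (-(c * n)) * Fintype.card (Fin (k + 1) → Fin m → Fin k → Fin n × Bool) ≤
          ((Finset.univ.filter fun Ψ : Fin (k + 1) → Fin m → Fin k → Fin n × Bool =>
            let P : Fin k → ℕ → Fin m → Fin k → Fin n × Bool :=
              fun r q a b => if (a : ℕ) * k + b < q then Ψ r.succ a b else Ψ r.castSucc a b
            (∀ r : Fin k, ∀ q ≤ m * k, ((Finset.univ.filter fun i : Fin m =>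
              ∀ j, g (P r q) (P r q i j).1 ≠ (P r q i j).2).card : ℝ) ≤ ν * m) ∧
            ∀ r : Fin k, ∀ q < m * k,
              (hammingDist (g (P r q)) (g (P r (q + 1))) : ℝ) ≤ η * n).card : ℝ) := by
  sorry

/-- **Stub 2 — child M: stable sections on the unclustered strip beyond Unit Clause (f-free).**  The same
conclusion for `2^k/k ≤ α < 2^k log k/k`, every fixed `k ≥ 3`, all `η, ν, c > 0`. -/
theorem stub_midDensity :
    ∀ k : ℕ, 3 ≤ k → ∀ α η ν : ℝ, 2 ^ k / k ≤ α → α < 2 ^ k * Real.log k / k → 0 < η → 0 < ν →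
      ∀ c : ℝ, 0 < c → ∀ᶠ n : ℕ in Filter.atTop, ∀ m : ℕ, m = ⌊α * n⌋₊ →
        ∃ g : (Fin m → Fin k → Fin n × Bool) → (Fin n → Bool),
          Real.exp (-(c * n)) * Fintype.card (Fin (k + 1) → Fin m → Fin k → Fin n × Bool) ≤
          ((Finset.univ.filter fun Ψ : Fin (k + 1) → Fin m → Fin k → Fin n × Bool =>
            let P : Fin k → ℕ → Fin m → Fin k → Fin n × Bool :=
              fun r q a b => if (a : ℕ) * k + b < q then Ψ r.succ a b else Ψ r.castSucc a b
            (∀ r : Fin k, ∀ q ≤ m * k, ((Finset.univ.filter fun i : Fin m =>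
              ∀ j, g (P r q) (P r q i j).1 ≠ (P r q i j).2).card : ℝ) ≤ ν * m) ∧
            ∀ r : Fin k, ∀ q < m * k,
              (hammingDist (g (P r q)) (g (P r (q + 1))) : ℝ) ≤ η * n).card : ℝ) := by
  sorry

/-- **Stub 3 — child T: the transfer on the core (THE BET; parked).**  The crux verbatim restricted to
`2^k log k/k ≤ α < 2^k log 2`, `0 < η < 1`, `0 < ν ≤ 2^{-k}`. -/
theorem stub_core :
    ∀ k : ℕ, 3 ≤ k → ∀ α η ν : ℝ, 2 ^ k * Real.log k / k ≤ α → α < 2 ^ k * Real.log 2 →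
      0 < η → η < 1 → 0 < ν → ν ≤ (1 / 2 : ℝ) ^ k →
      (∃ f : List Bool → List Bool, Literature.Computability.Complexity.IsPolyTime f ∧
        ∃ ε : ℝ, 0 < ε ∧ ∃ᶠ n : ℕ in Filter.atTop, ∀ m : ℕ, m = ⌊α * n⌋₊ → ε ≤
          ((Finset.univ.filter fun Φ : Fin m → Fin k → Fin n × Bool => ∀ i, ∃ j,
            (f (Literature.Computability.Complexity.encodingCNF.encode (List.ofFn fun a =>
              List.ofFn fun b => (((Φ a b).1 : ℕ), (Φ a b).2)))).getD (Φ i j).1 false =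
                (Φ i j).2).card : ℝ) / Fintype.card (Fin m → Fin k → Fin n × Bool)) →
      ∀ c : ℝ, 0 < c → ∃ᶠ n : ℕ in Filter.atTop, ∀ m : ℕ, m = ⌊α * n⌋₊ →
        ∃ g : (Fin m → Fin k → Fin n × Bool) → (Fin n → Bool),
          Real.exp (-(c * n)) * Fintype.card (Fin (k + 1) → Fin m → Fin k → Fin n × Bool) ≤
          ((Finset.univ.filter fun Ψ : Fin (k + 1) → Fin m → Fin k → Fin n × Bool =>
            let P : Fin k → ℕ → Fin m → Fin k → Fin n × Bool :=
              fun r q a b => if (a : ℕ) * k + b < q then Ψ r.succ a b else Ψ r.castSucc a b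
            (∀ r : Fin k, ∀ q ≤ m * k, ((Finset.univ.filter fun i : Fin m =>
              ∀ j, g (P r q) (P r q i j).1 ≠ (P r q i j).2).card : ℝ) ≤ ν * m) ∧
            ∀ r : Fin k, ∀ q < m * k,
              (hammingDist (g (P r q)) (g (P r (q + 1))) : ℝ) ≤ η * n).card : ℝ) := by
  sorry

/-- **The crux from the stubs:** case split on the density (children G, M), the tree's regimes
(`α ≥ 2^k log 2`: hypothesis false; `η ≥ 1`; `ν > 2^{-k}`), and the core (child T). -/
theorem SolvableImpliesStableSection_of :
    Summit.PneNP.PneNP.Theses.OverlapGapAlgebra.SolvableImpliesStableSection := by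
  intro k hk α η ν hα hη hν hsolv c hc
  have hk1 : 1 ≤ k := by omega
  -- (G) the Unit-Clause regime `α < 2^k/k`: f-free sections
  by_cases h1 : α < 2 ^ k / k
  · exact (stub_lowDensity k hk α η ν hα h1 hη hν c hc).frequently
  -- (M) the unclustered strip `2^k/k ≤ α < 2^k log k/k`: f-free sections
  by_cases h2 : α < 2 ^ k * Real.log k / k
  · exact (stub_midDensity k hk α η ν (not_lt.mp h1) h2 hη hν c hc).frequently
  -- the unsatisfiable regime `α ≥ 2^k log 2`: the hypothesis is false (first moment)
  by_cases h3 : (2 : ℝ) ^ k * Real.log 2 ≤ α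
  · exact absurd hsolv (Summit.PneNP.PneNP.Theorems.sissFM_hyp_false_of_density_ge_log_two k hk1 α h3)
  -- `η ≥ 1`: stability is vacuous, validity by the arg-max-sat boost
  by_cases h4 : 1 ≤ η
  · obtain ⟨f, -, ε, hε, hfreq⟩ := hsolv
    exact Summit.PneNP.PneNP.Cruxes.SolvableImpliesStableSection.Sketch.solvableImpliesStableSection_of_eta_ge_one
      k hk1 α η ν hα h4 hν ⟨f, ε, hε, hfreq⟩ c hc
  -- `ν > 2^{-k}`: the constant section
  by_cases h5 : (1 / 2 : ℝ) ^ k < ν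
  · exact Summit.PneNP.PneNP.Cruxes.SolvableImpliesStableSection.Sketch.solvableImpliesStableSection_of_nu_gt
      k hk1 α η ν hα hη h5 c hc
  -- (T) the core: the transfer itself
  exact stub_core k hk α η ν (not_lt.mp h2) (not_le.mp h3) hη (not_le.mp h4) hν (not_lt.mp h5)
    hsolv c hc


end Summit.PneNP.PneNP.Cruxes.SolvableImpliesStableSection.RegimeSplit
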